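import Summits.ABC.ABC.Theorems.CuspFieldPencilGoldenCuspShadow

/-!
Sketch (stub-ideation k1 g7, NOT a Theorems file): the verbatim stub `stub_conjugateCuspTriple` on REGIME I
(`min(rad u, rad w) ≤ rad(Q)²`) from the LANDED min-form `GoldenCuspShadowBaker.cuspMinRadBound_holds`.
-/

namespace Summit.ABC.ABC.Cruxes.GoldenCuspShadow.ConjK1G7

/-- H0 [S]: regime I of the verbatim stub, unconditional: `m ≤ q² ⇒ m = m^{2/3}·m^{1/3} ≤ q^{2/3}·m^{2/3}`. -/
theorem stub_conjugate_regimeI :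
    ∀ ε : ℝ, 0 < ε → ∃ κ : ℝ, ∀ u w : ℤ, IsCoprime u w → u * w * (u ^ 2 - 11 * u * w - w ^ 2) ≠ 0 →
      min (((UniqueFactorizationMonoid.radical u).natAbs : ℕ) : ℝ) (((UniqueFactorizationMonoid.radical w).natAbs : ℕ) : ℝ)
        ≤ ((((UniqueFactorizationMonoid.radical (u ^ 2 - 11 * u * w - w ^ 2)).natAbs : ℕ) : ℝ)) ^ 2 →
      Real.log (max (|(u : ℝ)|) (|(w : ℝ)|)) ≤
        κ * (((UniqueFactorizationMonoid.radical (u * w * (u ^ 2 - 11 * u * w - w ^ 2))).natAbs : ℕ) : ℝ) ^ (ε : ℝ) *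
          ((((UniqueFactorizationMonoid.radical (u ^ 2 - 11 * u * w - w ^ 2)).natAbs : ℕ) : ℝ) ^ (2 / 3 : ℝ) *
            (min (((UniqueFactorizationMonoid.radical u).natAbs : ℕ) : ℝ)
              (((UniqueFactorizationMonoid.radical w).natAbs : ℕ) : ℝ)) ^ (2 / 3 : ℝ)) := by
  sorry

/-- H3 [XS]: the complementary regime is what the K-side must pay for: `QSide` shape hypothesis ⇒ stub on regime II.
(`q² < m`, so a bound `κ R^ε (q·m')^{2/3}`-type from the conjugate pencil is needed; typed as an abstract hypothesis.) -/
theorem stub_conjugate_of_sides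
    (hQW : ∀ ε : ℝ, 0 < ε → ∃ κ : ℝ, ∀ u w : ℤ, IsCoprime u w → u * w * (u ^ 2 - 11 * u * w - w ^ 2) ≠ 0 →
      Real.log (max (|(u : ℝ)|) (|(w : ℝ)|)) ≤
        κ * (((UniqueFactorizationMonoid.radical (u * w * (u ^ 2 - 11 * u * w - w ^ 2))).natAbs : ℕ) : ℝ) ^ (ε : ℝ) *
          ((((UniqueFactorizationMonoid.radical (u ^ 2 - 11 * u * w - w ^ 2)).natAbs : ℕ) : ℝ) *
            (((UniqueFactorizationMonoid.radical w).natAbs : ℕ) : ℝ)) ^ (2 / 3 : ℝ))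
    (hQU : ∀ ε : ℝ, 0 < ε → ∃ κ : ℝ, ∀ u w : ℤ, IsCoprime u w → u * w * (u ^ 2 - 11 * u * w - w ^ 2) ≠ 0 →
      Real.log (max (|(u : ℝ)|) (|(w : ℝ)|)) ≤
        κ * (((UniqueFactorizationMonoid.radical (u * w * (u ^ 2 - 11 * u * w - w ^ 2))).natAbs : ℕ) : ℝ) ^ (ε : ℝ) *
          ((((UniqueFactorizationMonoid.radical (u ^ 2 - 11 * u * w - w ^ 2)).natAbs : ℕ) : ℝ) *
            (((UniqueFactorizationMonoid.radical u).natAbs : ℕ) : ℝ)) ^ (2 / 3 : ℝ)) :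
    ∀ ε : ℝ, 0 < ε → ∃ κ : ℝ, ∀ u w : ℤ, IsCoprime u w → u * w * (u ^ 2 - 11 * u * w - w ^ 2) ≠ 0 → Real.log (max (|(u : ℝ)|) (|(w : ℝ)|)) ≤ κ * (((UniqueFactorizationMonoid.radical (u * w * (u ^ 2 - 11 * u * w - w ^ 2))).natAbs : ℕ) : ℝ) ^ (ε : ℝ) * ((((UniqueFactorizationMonoid.radical (u ^ 2 - 11 * u * w - w ^ 2)).natAbs : ℕ) : ℝ) ^ (2 / 3 : ℝ) * (min (((UniqueFactorizationMonoid.radical u).natAbs : ℕ) : ℝ) (((UniqueFactorizationMonoid.radical w).natAbs : ℕ) : ℝ)) ^ (2 / 3 : ℝ)) := by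
  sorry

end Summit.ABC.ABC.Cruxes.GoldenCuspShadow.ConjK1G7
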